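import Mathlib
import Summits.Ventures.PercRepro2.Defs
import Summits.Ventures.PercRepro2.Independence

/-!
# The block pushforward: freezing an edge set to a pattern, collapsing it to one edge (blind cell
PercRepro2, typer-1 g54)

Measure-side tools for an exact reduction that replaces a whole edge set `S` by a single edge
`e₀ ∈ S` carrying the probability of a Boolean observable of `S`:

* **`freeze S σ ω`** — `ω` with its coordinates on `S` overwritten by the pattern `σ`;
  **`prob_freeze`**: under `p` it has the law `frozenWeights S σ p` (the weights on `S` replaced
  by the `0 / 1` weights of `σ`) — by the `glue` split of `Independence.lean` and the delta weight
  `weight_delta`;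
* **`blockMap S e₀ β ω`** — the coordinates of `ω` on `S` replaced by `β ω` at `e₀` and `false`
  elsewhere on `S`, for an observable `β` determined by the edges of `S` (`DependsOn β S`);
  **`prob_block_pushforward`**: its law under `p` is `blockWeights S e₀ (P_p(β)) p` — `S` closed
  except `e₀`, which carries the weight `P_p(β)`: the pinning identity at `e₀` on one side, and on
  the other the split `{β} ∩ freeze(1_{e₀})⁻¹ A ⊔ {β}ᶜ ∩ freeze(0)⁻¹ A` with the independence of
  `{β}` (an event of `S`) from a frozen event (an event of `Sᶜ`).
-/

namespace Summit.Ventures.PercRepro2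

namespace Block

/-! ## The delta weight of a pattern -/

section Delta

variable {ι : Type*} [Fintype ι] {R : Type*} [CommRing R]

/-- The `0 / 1` weights of a pattern `σ`: `1` where `σ` is open, `0` where it is closed. -/
def deltaWeights (σ : ι → Bool) : ι → R := fun i => if σ i then 1 else 0

/-- Under the `0 / 1` weights of `σ` only the configuration `σ` carries weight, and it has
weight one. -/
lemma weight_delta (σ τ : ι → Bool) :
    weight (deltaWeights σ : ι → R) τ = if τ = σ then 1 else 0 := by
  by_cases h : τ = σ
  · subst h
    rw [if_pos rfl]
    unfold weight
    refine Finset.prod_eq_one fun i _ => ?_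
    cases hσ : τ i <;> simp [deltaWeights, edgeFactor, hσ]
  · rw [if_neg h]
    obtain ⟨i, hi⟩ : ∃ i, τ i ≠ σ i := by
      by_contra hc
      push Not at hc
      exact h (funext hc)
    unfold weight
    refine Finset.prod_eq_zero (Finset.mem_univ i) ?_
    cases hτ : τ i <;> cases hσ : σ i <;> simp_all [deltaWeights, edgeFactor]

/-- The indicator of a preimage is the indicator composed with the map. -/
lemma indicator_preimage_one {α β : Type*} (f : α → β) (A : Set β) (x : α) :
    (f ⁻¹' A).indicator (1 : α → R) x = A.indicator (1 : β → R) (f x) := by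
  by_cases h : f x ∈ A
  · rw [Set.indicator_of_mem h, Set.indicator_of_mem (show x ∈ f ⁻¹' A from h)]
    rfl
  · rw [Set.indicator_of_notMem h, Set.indicator_of_notMem (show x ∉ f ⁻¹' A from h)]

end Delta

/-! ## Freezing an edge set to a pattern -/

section Freeze

variable {E : Type*} [Fintype E] [DecidableEq E] {R : Type*} [CommRing R]

/-- `freeze S σ ω`: the configuration `ω` with its coordinates on `S` overwritten by `σ`. -/
def freeze (S : Set E) [DecidablePred (· ∈ S)] (σ : E → Bool) (ω : Config E) : Config E :=
  fun e => if e ∈ S then σ e else ω e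

/-- The weights `p` with the coordinates on `S` frozen to the `0 / 1` weights of `σ`. -/
def frozenWeights (S : Set E) [DecidablePred (· ∈ S)] (σ : E → Bool) (p : E → R) : E → R :=
  fun e => if e ∈ S then (if σ e then 1 else 0) else p e

omit [Fintype E] [DecidableEq E] in
/-- `freeze` on an edge of `S`. -/
lemma freeze_apply_of_mem {S : Set E} [DecidablePred (· ∈ S)] {σ : E → Bool} {ω : Config E}
    {e : E} (h : e ∈ S) : freeze S σ ω e = σ e := by
  simp [freeze, h]

omit [Fintype E] [DecidableEq E] in
/-- `freeze` on an edge outside `S`. -/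
lemma freeze_apply_of_notMem {S : Set E} [DecidablePred (· ∈ S)] {σ : E → Bool} {ω : Config E}
    {e : E} (h : e ∉ S) : freeze S σ ω e = ω e := by
  simp [freeze, h]

omit [Fintype E] [DecidableEq E] in
/-- `freeze S σ` of a glued configuration is the glue of `σ` (restricted to `S`) with the
outside part. -/
lemma freeze_glue (S : Set E) [DecidablePred (· ∈ S)] (σ : E → Bool)
    (σ₁ : {e // e ∈ S} → Bool) (σ₂ : {e // e ∉ S} → Bool) :
    freeze S σ (glue S σ₁ σ₂) = glue S (fun i => σ i) σ₂ := by
  funext e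
  by_cases h : e ∈ S
  · rw [freeze_apply_of_mem h, glue_apply_of_mem S _ _ h]
  · rw [freeze_apply_of_notMem h, glue_apply_of_notMem S _ _ h, glue_apply_of_notMem S _ _ h]

omit [Fintype E] [DecidableEq E] in
/-- An event stated about `freeze S σ ω` is determined by the edges outside `S`. -/
lemma dependsOn_freeze (S : Set E) [DecidablePred (· ∈ S)] (σ : E → Bool)
    (A : Set (Config E)) : DependsOn (· ∈ freeze S σ ⁻¹' A) Sᶜ := by
  intro ω ω' h
  have : freeze S σ ω = freeze S σ ω' := by
    funext e
    by_cases he : e ∈ S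
    · rw [freeze_apply_of_mem he, freeze_apply_of_mem he]
    · rw [freeze_apply_of_notMem he, freeze_apply_of_notMem he, h e he]
  show (freeze S σ ω ∈ A) = (freeze S σ ω' ∈ A)
  rw [this]

/-- **The frozen pushforward**: under `p`, `freeze S σ` has the law `frozenWeights S σ p`. -/
theorem prob_freeze (p : E → R) (S : Set E) [DecidablePred (· ∈ S)] (σ : E → Bool)
    (A : Set (Config E)) :
    prob (frozenWeights S σ p) A = prob p (freeze S σ ⁻¹' A) := by
  rw [prob_eq_expect_indicator, prob_eq_expect_indicator, expect_eq_sum_glue _ _ S,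
    expect_eq_sum_glue _ _ S]
  have hL : ∀ σ₁ : {e // e ∈ S} → Bool,
      weight (fun i : {e // e ∈ S} => frozenWeights S σ p i) σ₁ =
        if σ₁ = (fun i : {e // e ∈ S} => σ i) then 1 else 0 := by
    intro σ₁
    have : (fun i : {e // e ∈ S} => frozenWeights S σ p i) =
        deltaWeights (fun i : {e // e ∈ S} => σ i) := by
      funext i
      simp [frozenWeights, deltaWeights, i.2]
    rw [this, weight_delta]
  have hR : ∀ σ₂ : {e // e ∉ S} → Bool,
      weight (fun i : {e // e ∉ S} => frozenWeights S σ p i) σ₂ =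
        weight (fun i : {e // e ∉ S} => p i) σ₂ := by
    intro σ₂
    have : (fun i : {e // e ∉ S} => frozenWeights S σ p i) = fun i : {e // e ∉ S} => p i := by
      funext i
      simp [frozenWeights, i.2]
    rw [this]
  have hsum : ∑ σ₁ : {e // e ∈ S} → Bool, weight (fun i : {e // e ∈ S} => p i) σ₁ = 1 :=
    sum_weight _
  -- the left side: only the pattern `σ` survives on `S`
  have eL : ∑ σ₁ : {e // e ∈ S} → Bool, ∑ σ₂ : {e // e ∉ S} → Bool,
      weight (fun i : {e // e ∈ S} => frozenWeights S σ p i) σ₁ *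
        weight (fun i : {e // e ∉ S} => frozenWeights S σ p i) σ₂ *
        A.indicator 1 (glue S σ₁ σ₂) =
      ∑ σ₂ : {e // e ∉ S} → Bool, weight (fun i : {e // e ∉ S} => p i) σ₂ *
        A.indicator 1 (glue S (fun i => σ i) σ₂) := by
    rw [Finset.sum_eq_single (fun i : {e // e ∈ S} => σ i)]
    · refine Finset.sum_congr rfl fun σ₂ _ => ?_
      rw [hL, hR, if_pos rfl, one_mul]
    · intro σ₁ _ hne
      refine Finset.sum_eq_zero fun σ₂ _ => ?_
      rw [hL, if_neg hne, zero_mul, zero_mul]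
    · intro h
      exact absurd (Finset.mem_univ _) h
  -- the right side: the `S`-weights sum to one
  have eR : ∑ σ₁ : {e // e ∈ S} → Bool, ∑ σ₂ : {e // e ∉ S} → Bool,
      weight (fun i : {e // e ∈ S} => p i) σ₁ * weight (fun i : {e // e ∉ S} => p i) σ₂ *
        (freeze S σ ⁻¹' A).indicator 1 (glue S σ₁ σ₂) =
      ∑ σ₂ : {e // e ∉ S} → Bool, weight (fun i : {e // e ∉ S} => p i) σ₂ *
        A.indicator 1 (glue S (fun i => σ i) σ₂) := by
    rw [Finset.sum_comm]
    refine Finset.sum_congr rfl fun σ₂ _ => ?_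
    calc ∑ σ₁ : {e // e ∈ S} → Bool,
          weight (fun i : {e // e ∈ S} => p i) σ₁ * weight (fun i : {e // e ∉ S} => p i) σ₂ *
            (freeze S σ ⁻¹' A).indicator 1 (glue S σ₁ σ₂)
        = ∑ σ₁ : {e // e ∈ S} → Bool, weight (fun i : {e // e ∈ S} => p i) σ₁ *
            (weight (fun i : {e // e ∉ S} => p i) σ₂ *
              A.indicator 1 (glue S (fun i => σ i) σ₂)) := by
          refine Finset.sum_congr rfl fun σ₁ _ => ?_
          rw [indicator_preimage_one, freeze_glue]
          ring
      _ = weight (fun i : {e // e ∉ S} => p i) σ₂ *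
            A.indicator 1 (glue S (fun i => σ i) σ₂) := by
          rw [← Finset.sum_mul, hsum, one_mul]
  rw [eL, eR]

end Freeze

/-! ## Collapsing an edge set to one edge -/

section Block

variable {E : Type*} [Fintype E] [DecidableEq E] {R : Type*} [CommRing R]

/-- The pattern `1_{e₀}`: open exactly at `e₀`. -/
def onePat (e₀ : E) : E → Bool := fun e => decide (e = e₀)

/-- **The block map**: the coordinates of `ω` on `S` are replaced by `β ω` at `e₀` and `false`
elsewhere on `S`; outside `S` nothing changes. -/
def blockMap (S : Set E) [DecidablePred (· ∈ S)] (e₀ : E) (β : Config E → Bool)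
    (ω : Config E) : Config E :=
  fun e => if e = e₀ then β ω else if e ∈ S then false else ω e

/-- **The block weights**: `q₀` at `e₀`, `0` elsewhere on `S`, `p` outside `S`. -/
def blockWeights (S : Set E) [DecidablePred (· ∈ S)] (e₀ : E) (q₀ : R) (p : E → R) : E → R :=
  fun e => if e = e₀ then q₀ else if e ∈ S then 0 else p e

omit [Fintype E] in
/-- The block map is the freeze to `1_{e₀}` when `β` holds and the freeze to `0` otherwise. -/
lemma blockMap_eq (S : Set E) [DecidablePred (· ∈ S)] {e₀ : E} (he₀ : e₀ ∈ S)
    (β : Config E → Bool) (ω : Config E) :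
    blockMap S e₀ β ω =
      if β ω = true then freeze S (onePat e₀) ω else freeze S (fun _ => false) ω := by
  funext e
  by_cases h : e = e₀
  · subst h
    cases hβ : β ω <;> simp [blockMap, freeze, onePat, he₀, hβ]
  · cases hβ : β ω <;> simp [blockMap, freeze, onePat, h]

omit [Fintype E] in
/-- The preimage under the block map splits along `{β}`. -/
lemma preimage_blockMap (S : Set E) [DecidablePred (· ∈ S)] {e₀ : E} (he₀ : e₀ ∈ S)
    (β : Config E → Bool) (A : Set (Config E)) :
    blockMap S e₀ β ⁻¹' A =
      ({ω | β ω = true} ∩ freeze S (onePat e₀) ⁻¹' A) ∪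
        ({ω | β ω = true}ᶜ ∩ freeze S (fun _ => false) ⁻¹' A) := by
  ext ω
  simp only [Set.mem_preimage, Set.mem_union, Set.mem_inter_iff, Set.mem_setOf_eq,
    Set.mem_compl_iff, blockMap_eq S he₀ β ω]
  cases hβ : β ω <;> simp

omit [Fintype E] [DecidableEq E] in
/-- The event `{β}` of an observable determined by `S` is determined by `S`. -/
lemma dependsOn_setOf_eq_true {S : Set E} {β : Config E → Bool} (hβ : DependsOn β S) :
    DependsOn (· ∈ {ω : Config E | β ω = true}) S := by
  intro ω ω' h
  show (β ω = true) = (β ω' = true)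
  rw [hβ h]

omit [Fintype E] in
/-- The block weights are the frozen weights of `0` pinned to `q₀` at `e₀`. -/
lemma blockWeights_eq_update (S : Set E) [DecidablePred (· ∈ S)] {e₀ : E} (he₀ : e₀ ∈ S)
    (q₀ : R) (p : E → R) :
    blockWeights S e₀ q₀ p = Function.update (frozenWeights S (fun _ => false) p) e₀ q₀ := by
  funext e
  by_cases h : e = e₀
  · subst h
    simp [blockWeights]
  · rw [Function.update_of_ne h]
    simp [blockWeights, frozenWeights, h]

omit [Fintype E] in
/-- The frozen weights of `0` pinned to `1` at `e₀ ∈ S` are the frozen weights of `1_{e₀}`. -/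
lemma update_frozen_one (S : Set E) [DecidablePred (· ∈ S)] {e₀ : E} (he₀ : e₀ ∈ S)
    (p : E → R) :
    Function.update (frozenWeights S (fun _ => false) p) e₀ 1 = frozenWeights S (onePat e₀) p := by
  funext e
  by_cases h : e = e₀
  · subst h
    simp [frozenWeights, onePat, he₀]
  · rw [Function.update_of_ne h]
    simp [frozenWeights, onePat, h]

omit [Fintype E] in
/-- The frozen weights of `0` pinned to `0` at `e₀ ∈ S` are themselves. -/
lemma update_frozen_zero (S : Set E) [DecidablePred (· ∈ S)] {e₀ : E} (he₀ : e₀ ∈ S)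
    (p : E → R) :
    Function.update (frozenWeights S (fun _ => false) p) e₀ 0 =
      frozenWeights S (fun _ => false) p := by
  funext e
  by_cases h : e = e₀
  · subst h
    simp [frozenWeights, he₀]
  · simp [Function.update_of_ne h]

/-- **The block pushforward**: for an observable `β` determined by the edges of `S ∋ e₀`, the
block map has, under `p`, the law `blockWeights S e₀ (P_p(β)) p` — `S` closed except `e₀`,
which carries the weight `P_p(β)`. -/
theorem prob_block_pushforward (p : E → R) (S : Set E) [DecidablePred (· ∈ S)] {e₀ : E}
    (he₀ : e₀ ∈ S) {β : Config E → Bool} (hβ : DependsOn β S) (A : Set (Config E)) :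
    prob (blockWeights S e₀ (prob p {ω | β ω = true}) p) A =
      prob p (blockMap S e₀ β ⁻¹' A) := by
  -- the right side: split along `{β}`, independence, the two frozen laws
  have hdisj : Disjoint ({ω : Config E | β ω = true} ∩ freeze S (onePat e₀) ⁻¹' A)
      ({ω : Config E | β ω = true}ᶜ ∩ freeze S (fun _ => false) ⁻¹' A) :=
    Set.disjoint_of_subset Set.inter_subset_left Set.inter_subset_left disjoint_compl_right
  have hB := dependsOn_setOf_eq_true hβ
  rw [preimage_blockMap S he₀ β A, prob_union_of_disjoint p hdisj,
    prob_inter_eq_mul_of_dependsOn_compl p S hB (dependsOn_freeze S _ A),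
    prob_inter_eq_mul_of_dependsOn_compl p S (dependsOn_compl hB) (dependsOn_freeze S _ A),
    prob_compl, ← prob_freeze, ← prob_freeze]
  -- the left side: pin `e₀`
  rw [blockWeights_eq_update S he₀, prob_eq_pin _ A e₀, Function.update_self,
    Function.update_idem, Function.update_idem, update_frozen_one S he₀, update_frozen_zero S he₀]

end Block

end Block

end Summit.Ventures.PercRepro2
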